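import Literature.NumberTheory.LFunctions.ClassGroupPsiErrorTerm
import Literature.NumberTheory.LFunctions.DegreeOnePrimesPNT
import Literature.NumberTheory.LFunctions.ExpTypePrimeSumsResidue
import HarnessLib

/-!
# The degree-one primes of an ideal class: prime number theorem with remainder

Topic `Literature/NumberTheory/LFunctions` (namespace `Literature.NumberTheory.LFunctions.NumberField`).
Everything here is PROVED (two definitions with bodies, theorems; no named facts).

For a number field `K`, an ideal class `C ∈ Cl_K` and a rational prime `p` let
`w_C(p) = #{𝔭 : N𝔭 = p, [𝔭] = C}` (`classNormIdealCount K C p`; the prime ideals of degree one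
above `p` lying in `C`).  We prove the prime number theorem for these weighted primes with the
classical remainder,

  `|Σ_{p ≤ x} w_C(p) log p − x/h_K| ≤ C x exp(−c √log x)`,  hence `≤ C_A x/(log x)^A`,

for `x ≥ 2` (`classDegreeOne_thetaW_sub_le`, `classDegreeOne_thetaW_sub_le_logPow`), in the
currency `ExpTypePrimeSums.thetaW` of the weighted denseness core
`Literature.NumberTheory.LFunctions.entire_eq_zero_of_summable_wprimes` (Bayart–Matheron
Lemmas 11.15–11.16): this is the arithmetic input of the joint denseness of finite Euler products of
class group `L`-functions (Voronin 1976 / Karatsuba–Voronin Ch. VII §3).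

Proof: with `Λ_C` of `ClassGroupPsiErrorTerm.lean`, `Λ_C(p) = h w_C(p) log p` for primes `p`
(every ideal of prime norm is a prime ideal with `Λ = log p`), `Λ_C ≥ 0`, and
`Σ_C Λ_C(n) = h Σ_{N𝔞=n} Λ(𝔞)`; hence
`0 ≤ Σ_{n≤x} Λ_C(n) − h θ_{w_C}(x) ≤ Σ_C (…) = h(Σ_{n ≤ x} Σ_{N𝔞=n}Λ(𝔞) − Σ_{p≤x} c_K(p) log p)`,
which is `≪ x exp(−c√log x)` by `classVonMangoldt_psi_le` (summed over the classes) and the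
degree-one prime ideal theorem of the tree (`abs_degreeOneTheta_sub_self_le`).

## References

* E. Landau, *Über Ideale und Primideale in Idealklassen*, Math. Z. 2 (1918), 52–154.
* J. Thorner, A. Zaman, Algebra Number Theory 13 (2019), Thm. 1.4. [ThornerZaman2019]
* F. Bayart, É. Matheron, *Dynamics of Linear Operators*, CUP 2009, Lemmas 11.15–11.16.
  [BayartMatheron2009]
-/

noncomputable section

open scoped NumberField nonZeroDivisors
open NumberField Complex Filter Topology Set Finset
open Literature.NumberTheory.LFunctions.ExpTypePrimeSums (thetaW)

namespace Literature.NumberTheory.LFunctions.NumberField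

variable (K : Type*) [Field K] [NumberField K]

/-! ### The ideals of norm `n` in a class -/

/-- `[𝔞] = C` for a nonzero ideal (false for the zero ideal). [folklore] -/
def IdealInClass (C : ClassGroup (𝓞 K)) (I : Ideal (𝓞 K)) : Prop :=
  ∃ h : I ≠ ⊥, ClassGroup.mk0 ⟨I, mem_nonZeroDivisors_of_ne_zero h⟩ = C

open scoped Classical in
/-- `w_C(n) = #{𝔞 : N𝔞 = n, [𝔞] = C}`; for a prime `n = p` this is the number of degree-one prime
ideals above `p` in the class `C`. [folklore] -/
def classNormIdealCount (C : ClassGroup (𝓞 K)) (n : ℕ) : ℕ :=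
  ((idealsOfNorm K n).filter (IdealInClass K C)).card

variable {K}

/-- `classVonMangoldtIdeal C I = [ [I] = C ] Λ(I)`. [folklore] -/
theorem classVonMangoldtIdeal_eq (C : ClassGroup (𝓞 K)) (I : Ideal (𝓞 K)) [Decidable (IdealInClass K C I)] :
    classVonMangoldtIdeal K C I = if IdealInClass K C I then idealVonMangoldt I else 0 := by
  classical
  unfold classVonMangoldtIdeal IdealInClass
  by_cases hI : I = ⊥
  · simp [hI]
  · rw [dif_neg hI]
    by_cases hC : ClassGroup.mk0 ⟨I, mem_nonZeroDivisors_of_ne_zero hI⟩ = C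
    · rw [if_pos hC, if_pos ⟨hI, hC⟩]
    · rw [if_neg hC, if_neg (fun ⟨_, h⟩ ↦ hC h)]

open scoped Classical in
/-- `Λ_C(n) = h Σ_{N𝔞 = n, [𝔞] = C} Λ(𝔞)`. [folklore] -/
theorem classVonMangoldt_eq_sum_filter (C : ClassGroup (𝓞 K)) (n : ℕ) :
    classVonMangoldt K C n = (Fintype.card (ClassGroup (𝓞 K)) : ℝ) *
      ∑ I ∈ (idealsOfNorm K n).filter (fun I ↦ IdealInClass K C I), idealVonMangoldt I := by
  classical
  rw [classVonMangoldt, Finset.sum_filter]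
  congr 1
  exact Finset.sum_congr rfl fun I _ ↦ classVonMangoldtIdeal_eq C I

/-- An ideal of prime norm `p` is a prime ideal with `Λ = log p`. [folklore] -/
theorem idealVonMangoldt_of_absNorm_prime {I : Ideal (𝓞 K)} {p : ℕ} (hp : p.Prime)
    (hI : Ideal.absNorm I = p) : idealVonMangoldt I = Real.log p := by
  have hirr : Irreducible (Ideal.absNorm I) := by rw [hI]; exact hp
  have hprime : I.IsPrime := Ideal.isPrime_of_irreducible_absNorm hirr
  have hI0 : I ≠ ⊥ := by
    intro h; rw [h, Ideal.absNorm_bot] at hI; exact hp.ne_zero hI.symm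
  have hP : Prime I := Ideal.prime_of_isPrime hI0 hprime
  have := idealVonMangoldt_prime_pow hP one_ne_zero
  rw [pow_one] at this
  rw [this, hI]

/-- **`Λ_C(p) = h · w_C(p) · log p`** for a prime `p`. [folklore] -/
theorem classVonMangoldt_prime (C : ClassGroup (𝓞 K)) {p : ℕ} (hp : p.Prime) :
    classVonMangoldt K C p =
      (Fintype.card (ClassGroup (𝓞 K)) : ℝ) * ((classNormIdealCount K C p : ℝ) * Real.log p) := by
  classical
  rw [classVonMangoldt_eq_sum_filter, classNormIdealCount]
  congr 1
  rw [Finset.card_eq_sum_ones, Nat.cast_sum, Finset.sum_mul]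
  refine Finset.sum_congr rfl fun I hI ↦ ?_
  rw [Finset.mem_filter, mem_idealsOfNorm] at hI
  rw [idealVonMangoldt_of_absNorm_prime hp hI.1]; push_cast; ring

/-- **`Σ_C Λ_C(n) = h Σ_{N𝔞 = n} Λ(𝔞)`** (every nonzero ideal lies in exactly one class;
`Λ(0) = 0`). [folklore] -/
theorem sum_classVonMangoldt (n : ℕ) :
    ∑ C : ClassGroup (𝓞 K), classVonMangoldt K C n =
      (Fintype.card (ClassGroup (𝓞 K)) : ℝ) * vonMangoldtNorm K n := by
  classical
  simp only [classVonMangoldt, vonMangoldtNorm, ← Finset.mul_sum]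
  congr 1
  rw [Finset.sum_comm]
  refine Finset.sum_congr rfl fun I _ ↦ ?_
  by_cases hI : I = ⊥
  · subst hI
    simp [classVonMangoldtIdeal, idealVonMangoldt_bot]
  · simp only [classVonMangoldtIdeal, dif_neg hI]
    rw [Finset.sum_ite_eq]
    simp

/-- `Σ_{N𝔞 = p} Λ(𝔞) = c_K(p) log p` for a prime `p`. [folklore] -/
theorem vonMangoldtNorm_prime {p : ℕ} (hp : p.Prime) :
    vonMangoldtNorm K p = (idealNormCount K p : ℝ) * Real.log p := by
  rw [vonMangoldtNorm, ← card_idealsOfNorm, Finset.card_eq_sum_ones, Nat.cast_sum, Finset.sum_mul]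
  refine Finset.sum_congr rfl fun I hI ↦ ?_
  rw [mem_idealsOfNorm] at hI
  rw [idealVonMangoldt_of_absNorm_prime hp hI]; push_cast; ring

/-- The prime filter of `(0, ⌊x⌋]` is `Nat.primesLE ⌊x⌋`. [folklore] -/
theorem filter_prime_Ioc_eq (N : ℕ) : (Finset.Ioc 0 N).filter Nat.Prime = Nat.primesLE N := by
  ext p
  simp only [Finset.mem_filter, Finset.mem_Ioc, Nat.primesLE, Nat.mem_primesBelow]
  constructor
  · rintro ⟨⟨-, h2⟩, hp⟩; exact ⟨by omega, hp⟩
  · rintro ⟨h1, hp⟩; exact ⟨⟨hp.pos, by omega⟩, hp⟩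

/-- `h θ_{w_C}(x) = Σ_{p ≤ x prime} Λ_C(p)`. [folklore] -/
theorem card_mul_thetaW_eq (C : ClassGroup (𝓞 K)) (x : ℝ) :
    (Fintype.card (ClassGroup (𝓞 K)) : ℝ) * thetaW (fun n ↦ (classNormIdealCount K C n : ℝ)) x =
      ∑ p ∈ (Finset.Ioc 0 ⌊x⌋₊).filter Nat.Prime, classVonMangoldt K C p := by
  rw [thetaW, Finset.mul_sum]
  refine Finset.sum_congr rfl fun p hp ↦ ?_
  rw [classVonMangoldt_prime C (Finset.mem_filter.1 hp).2]

/-- `Σ_{p ≤ x prime} Σ_{N𝔞=p} Λ(𝔞) = Σ_{p ≤ x} c_K(p) log p` (`degreeOneTheta`). [folklore] -/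
theorem sum_filter_prime_vonMangoldtNorm_eq (x : ℝ) :
    ∑ p ∈ (Finset.Ioc 0 ⌊x⌋₊).filter Nat.Prime, vonMangoldtNorm K p = degreeOneTheta K x := by
  rw [degreeOneTheta, filter_prime_Ioc_eq]
  refine Finset.sum_congr rfl fun p hp ↦ ?_
  have hp' : p.Prime := (Nat.mem_primesBelow.1 hp).2
  exact vonMangoldtNorm_prime hp'

/-! ### The theorem -/

/-- **Prime number theorem with remainder for the degree-one primes of an ideal class**: for
every number field `K` and class `C` there are `c > 0`, `C'` with
`|Σ_{p ≤ x} w_C(p) log p − x/h_K| ≤ C' x exp(−c √log x)` for all `x ≥ 2`,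
`w_C(p) = #{𝔭 : N𝔭 = p, [𝔭] = C}`. [cite: ThornerZaman2019, Theorem 1.4 (fixed-field consequence)] -/
theorem classDegreeOne_thetaW_sub_le (C : ClassGroup (𝓞 K)) :
    ∃ c : ℝ, 0 < c ∧ ∃ C' : ℝ, ∀ x : ℝ, 2 ≤ x →
      |thetaW (fun n ↦ (classNormIdealCount K C n : ℝ)) x - x / Fintype.card (ClassGroup (𝓞 K))| ≤
        C' * x * Real.exp (-c * Real.sqrt (Real.log x)) := by
  classical
  set h : ℝ := (Fintype.card (ClassGroup (𝓞 K)) : ℝ) with hh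
  have hh0 : 0 < h := by rw [hh]; exact_mod_cast Fintype.card_pos
  -- the class prime ideal theorems, one per class, and the degree-one prime ideal theorem
  have hcls := fun D : ClassGroup (𝓞 K) ↦ classVonMangoldt_psi_le (K := K) D
  choose c' hc'0 C' hC' using hcls
  obtain ⟨c₁, hc₁, C₁, hdeg⟩ := abs_degreeOneTheta_sub_self_le K
  -- the common exponent
  have huniv : (Finset.univ : Finset (ClassGroup (𝓞 K))).Nonempty := Finset.univ_nonempty
  set c : ℝ := min c₁ (Finset.univ.inf' huniv c') with hc
  have hcpos : 0 < c := lt_min hc₁ (by rw [Finset.lt_inf'_iff]; exact fun D _ ↦ hc'0 D)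
  have hcle : ∀ D, c ≤ c' D := fun D ↦ (min_le_right _ _).trans (Finset.inf'_le _ (Finset.mem_univ D))
  have hcle₁ : c ≤ c₁ := min_le_left _ _
  -- constants (made nonnegative)
  set M : ℝ := ∑ D : ClassGroup (𝓞 K), max (C' D) 0 with hM
  have hM0 : 0 ≤ M := Finset.sum_nonneg fun D _ ↦ le_max_right _ _
  refine ⟨c, hcpos, (max (C' C) 0 + M + h * max C₁ 0) / h, fun x hx ↦ ?_⟩
  have hx0 : 0 < x := by linarith
  set E : ℝ := x * Real.exp (-c * Real.sqrt (Real.log x)) with hE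
  have hE0 : 0 ≤ E := by positivity
  -- each exponential error is dominated by the common one
  have hexp : ∀ c'' : ℝ, c ≤ c'' → Real.exp (-c'' * Real.sqrt (Real.log x)) ≤
      Real.exp (-c * Real.sqrt (Real.log x)) := fun c'' hc'' ↦
    Real.exp_le_exp.mpr (by nlinarith [Real.sqrt_nonneg (Real.log x)])
  have hSD : ∀ D : ClassGroup (𝓞 K),
      |(∑ n ∈ Finset.Ioc 0 ⌊x⌋₊, classVonMangoldt K D n) - x| ≤ max (C' D) 0 * E := by
    intro D
    refine (hC' D x hx).trans ?_
    rw [hE, ← mul_assoc]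
    calc C' D * x * Real.exp (-c' D * Real.sqrt (Real.log x))
        ≤ max (C' D) 0 * x * Real.exp (-c' D * Real.sqrt (Real.log x)) := by
          gcongr; exact le_max_left _ _
      _ ≤ max (C' D) 0 * x * Real.exp (-c * Real.sqrt (Real.log x)) :=
          mul_le_mul_of_nonneg_left (hexp _ (hcle D)) (by positivity)
  have hdegx : |degreeOneTheta K x - x| ≤ max C₁ 0 * E := by
    refine (hdeg x hx).trans ?_
    rw [hE, ← mul_assoc]
    calc C₁ * x * Real.exp (-c₁ * Real.sqrt (Real.log x))
        ≤ max C₁ 0 * x * Real.exp (-c₁ * Real.sqrt (Real.log x)) := by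
          gcongr; exact le_max_left _ _
      _ ≤ max C₁ 0 * x * Real.exp (-c * Real.sqrt (Real.log x)) :=
          mul_le_mul_of_nonneg_left (hexp _ hcle₁) (by positivity)
  -- the decomposition `S_D = h θ_D + R_D`, `R_D ≥ 0`
  set S : ClassGroup (𝓞 K) → ℝ := fun D ↦ ∑ n ∈ Finset.Ioc 0 ⌊x⌋₊, classVonMangoldt K D n with hS
  set R : ClassGroup (𝓞 K) → ℝ := fun D ↦
    ∑ n ∈ (Finset.Ioc 0 ⌊x⌋₊).filter (fun n ↦ ¬ n.Prime), classVonMangoldt K D n with hR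
  have hsplit : ∀ D, S D = h * thetaW (fun n ↦ (classNormIdealCount K D n : ℝ)) x + R D := by
    intro D
    rw [card_mul_thetaW_eq, hS, hR]
    exact (Finset.sum_filter_add_sum_filter_not _ _ _).symm
  have hR0 : ∀ D, 0 ≤ R D := fun D ↦ Finset.sum_nonneg fun n _ ↦ classVonMangoldt_nonneg D n
  -- `Σ_D R_D = h (Σ_n Λ_K-norm − degreeOneTheta)` and `Σ_D S_D = h Σ_n Λ_K-norm`
  have hsumS : ∑ D, S D = h * ∑ n ∈ Finset.Ioc 0 ⌊x⌋₊, vonMangoldtNorm K n := by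
    simp only [hS]
    rw [Finset.sum_comm, Finset.mul_sum]
    exact Finset.sum_congr rfl fun n _ ↦ sum_classVonMangoldt n
  have hsumR : ∑ D, R D = h * ((∑ n ∈ Finset.Ioc 0 ⌊x⌋₊, vonMangoldtNorm K n) - degreeOneTheta K x) := by
    have h1 : ∑ D, R D = h * ∑ n ∈ (Finset.Ioc 0 ⌊x⌋₊).filter (fun n ↦ ¬ n.Prime), vonMangoldtNorm K n := by
      simp only [hR]
      rw [Finset.sum_comm, Finset.mul_sum]
      exact Finset.sum_congr rfl fun n _ ↦ sum_classVonMangoldt n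
    rw [h1, ← sum_filter_prime_vonMangoldtNorm_eq (K := K) x,
      ← Finset.sum_filter_add_sum_filter_not (Finset.Ioc 0 ⌊x⌋₊) Nat.Prime (vonMangoldtNorm K)]
    ring
  -- bounds
  have hRle : R C ≤ ∑ D, R D :=
    Finset.single_le_sum (fun D _ ↦ hR0 D) (Finset.mem_univ C)
  have hsumSx : |(∑ n ∈ Finset.Ioc 0 ⌊x⌋₊, vonMangoldtNorm K n) - x| ≤ M * E / h := by
    have h1 : h * ((∑ n ∈ Finset.Ioc 0 ⌊x⌋₊, vonMangoldtNorm K n) - x) = ∑ D, (S D - x) := by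
      rw [Finset.sum_sub_distrib, hsumS, Finset.sum_const, Finset.card_univ, nsmul_eq_mul, ← hh]; ring
    have h2 : |∑ D, (S D - x)| ≤ M * E := by
      refine (Finset.abs_sum_le_sum_abs _ _).trans ?_
      rw [hM, Finset.sum_mul]
      exact Finset.sum_le_sum fun D _ ↦ hSD D
    rw [le_div_iff₀ hh0, ← abs_of_pos hh0, ← abs_mul, mul_comm, h1]
    exact h2
  have hsumRle : ∑ D, R D ≤ M * E + h * (max C₁ 0 * E) := by
    rw [hsumR]
    have h1 : (∑ n ∈ Finset.Ioc 0 ⌊x⌋₊, vonMangoldtNorm K n) - x ≤ M * E / h :=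
      (le_abs_self _).trans hsumSx
    have h2 : x - degreeOneTheta K x ≤ max C₁ 0 * E := by
      have := hdegx; rw [abs_sub_comm] at this; exact (le_abs_self _).trans this
    calc h * ((∑ n ∈ Finset.Ioc 0 ⌊x⌋₊, vonMangoldtNorm K n) - degreeOneTheta K x)
        = h * (((∑ n ∈ Finset.Ioc 0 ⌊x⌋₊, vonMangoldtNorm K n) - x) + (x - degreeOneTheta K x)) := by ring
      _ ≤ h * (M * E / h + max C₁ 0 * E) := by gcongr
      _ = M * E + h * (max C₁ 0 * E) := by field_simp
  -- conclusion
  have hθ : thetaW (fun n ↦ (classNormIdealCount K C n : ℝ)) x - x / h = ((S C - x) - R C) / h := by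
    rw [hsplit C]; field_simp; ring
  rw [hθ, abs_div, abs_of_pos hh0, div_le_iff₀ hh0]
  calc |S C - x - R C| ≤ |S C - x| + |R C| := abs_sub _ _
    _ ≤ max (C' C) 0 * E + (M * E + h * (max C₁ 0 * E)) := by
        rw [abs_of_nonneg (hR0 C)]; exact add_le_add (hSD C) (hRle.trans hsumRle)
    _ = (max (C' C) 0 + M + h * max C₁ 0) / h * x * Real.exp (-c * Real.sqrt (Real.log x)) * h := by
        rw [hE]; field_simp; ring

/-- The same in the `(log x)^{-A}` currency: for every real `A` there is `C'` with
`|Σ_{p ≤ x} w_C(p) log p − x/h_K| ≤ C' x/(log x)^A` for `x ≥ 2` (the input shape of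
`entire_eq_zero_of_summable_wprimes`, `A = 3`). [folklore] -/
theorem classDegreeOne_thetaW_sub_le_logPow (C : ClassGroup (𝓞 K)) (A : ℝ) :
    ∃ C' : ℝ, ∀ x : ℝ, 2 ≤ x →
      |thetaW (fun n ↦ (classNormIdealCount K C n : ℝ)) x -
          (1 / Fintype.card (ClassGroup (𝓞 K))) * x| ≤ C' * x / Real.log x ^ A := by
  obtain ⟨c, hc, C', hC'⟩ := classDegreeOne_thetaW_sub_le (K := K) C
  set h : ℝ := (Fintype.card (ClassGroup (𝓞 K)) : ℝ) with hh
  have hh0 : 0 < h := by rw [hh]; exact_mod_cast Fintype.card_pos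
  -- apply `logPow_of_expSqrt` to `f = h θ`
  have hf : ∀ x : ℝ, 2 ≤ x → |h * thetaW (fun n ↦ (classNormIdealCount K C n : ℝ)) x - x| ≤
      (h * C') * x / Real.exp (c * Real.sqrt (Real.log x)) := by
    intro x hx
    have h1 := hC' x hx
    have h2 : h * thetaW (fun n ↦ (classNormIdealCount K C n : ℝ)) x - x =
        h * (thetaW (fun n ↦ (classNormIdealCount K C n : ℝ)) x - x / h) := by field_simp
    rw [h2, abs_mul, abs_of_pos hh0, mul_div_assoc, mul_assoc]
    refine mul_le_mul_of_nonneg_left ?_ hh0.le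
    rwa [neg_mul, Real.exp_neg, ← div_eq_mul_inv, mul_div_assoc] at h1
  obtain ⟨C'', hC''⟩ := logPow_of_expSqrt hc hf A
  refine ⟨C'' / h, fun x hx ↦ ?_⟩
  have h1 := hC'' x hx
  have h2 : thetaW (fun n ↦ (classNormIdealCount K C n : ℝ)) x - 1 / h * x =
      (h * thetaW (fun n ↦ (classNormIdealCount K C n : ℝ)) x - x) / h := by field_simp
  rw [h2, abs_div, abs_of_pos hh0, div_le_iff₀ hh0]
  calc |h * thetaW (fun n ↦ (classNormIdealCount K C n : ℝ)) x - x| ≤ C'' * x / Real.log x ^ A := h1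
    _ = C'' / h * x / Real.log x ^ A * h := by field_simp

end Literature.NumberTheory.LFunctions.NumberField
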